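import Literature.Geometry.Kaehler.RiemannSurfaceLinearCharactersIntermediateQuotient
import HarnessLib

/-!
# `𝓗¹(M)^{G'} = ⊕_{Q cyclic quotient of G} T₀^*B_Q`: the parts `B_Q = ⊕_{ψ : ker ψ = N} E_ψ` of `𝓗¹(M)` are
# independent for any finite `G ≤ Aut M`, and fill `𝓗¹(M)` for abelian `G`
# (Kopeliovich–Zemel, Theorem 7.3: «`∏_Q B_Q → J(X)` has finite kernel … In case `G` is Abelian … surjective»)

Layer `Literature/Geometry/Kaehler`, companion of `RiemannSurfacePrimitivePrymCyclicCovers` (complementary partial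
sums `⊕_{p(χ)} E_χ ⊕ ⊕_{¬p(χ)} E_χ` of the eigenspaces of a finite abelian group), sequel of
`RiemannSurfaceAbelianGroupEigenspaceDecomposition` (the `E_χ`, `χ ∈ Ĝ`, are independent for ANY finite `G`;
`W = ⊕_χ E_χ` for abelian `G`), of `RiemannSurfaceLinearCharactersCommutatorQuotient` (`⊕_χ E_χ = W^{G'}`) and of
`RiemannSurfaceAbelianCoverCyclicQuotientDecomposition` (the DIMENSIONS `dim B_Q`, `g = Σ_Q dim B_Q`). Source as
printed (Y. Kopeliovich, S. Zemel, Israel J. Math. 234 (2019), Theorem 7.3, arXiv:1609.02296 p. 32):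

> **Theorem 7.3.** Let `Q = G/N` be a cyclic quotient of `G`. Then one associates with `Q` a canonical subvariety
> of `J(X)`, which we denote by `B_Q`, whose dimension equals `φ(|Q|)[g_S − 1 + δ + Σ_{C ⊄ N} r_C/2]` […]. The map
> `∏_Q B_Q → J(X)`, where the product is taken over all the cyclic quotients of `G`, has finite kernel (i.e., it
> is injective on the level of the tangent spaces). In case `G` is Abelian, this map is surjective, and yields a
> decomposition of `J(X)` up to isogeny.
> (proof) […] if `χ ∈ Ĝ` is an embedding of `Q` into `S¹` then the other elements of `Ĝ` that are embeddings of
> the same quotient `Q` are precisely the images of `χ` under the Galois group `Γ_χ` […] Next, the map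
> `∏_Q B_Q → J(X)` has finite kernel since `∏_W A_W → J(X)` is an isogeny and the former product is a partial
> product of the latter. Finally, as all the complex irreducible representations of an Abelian group are
> characters, the last assertion follows as well.

At the level of `Ω(1) = 𝓗¹(M) = T₀J(X)^*` the part of `Q = G/N` is `B_N := ⊕_{ψ ∈ Ĝ : ker ψ = N} E_ψ(𝓗¹(M))` (the
characters that are «embeddings of `Q`»; `RiemannSurfaceAbelianCoverCyclicQuotientDecomposition` computes its
dimension), indexed here by ALL subgroups `N ≤ G` — `B_N = 0` unless `N` is the kernel of a character, i.e. unless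
`N ⊴ G` with `G/N` cyclic. «Injective on the level of the tangent spaces» becomes the INDEPENDENCE of the family
`(B_N)_N` (their sum is direct), «surjective for Abelian `G`» becomes `⊕_N B_N = 𝓗¹(M)` (an internal direct sum),
and in general `⊕_N B_N = ⊕_{χ ∈ Ĝ} E_χ = 𝓗¹(M)^{G'}` is the pull-back of `𝓗¹(M/G')`, `G' = [G, G]`.

## What is proved (no definitions, no named facts, no instances)

* §1 (finite `G`, any representation `W`): `biSup_biSup_iInf_eigenspace_ker_ne_le`,
  **`iSupIndep_biSup_iInf_eigenspace_ker`** (the `B_N = ⊕_{ker χ = N} E_χ`, `N ≤ G`, are independent — any finite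
  `G`), `iSup_biSup_iInf_eigenspace_ker_eq` (`Σ_N B_N = Σ_χ E_χ`), `iSup_biSup_iInf_eigenspace_ker_eq_invariants_commutator`
  (`= W^{G'}`), `biSup_iInf_eigenspace_ker_eq_bot_of_not_isCyclic` (`B_N = 0` unless `G/N` is cyclic),
  `biSup_iInf_eigenspace_ker_eq_bot_of_not_normal`, **`isInternal_biSup_iInf_eigenspace_ker`** (abelian `G`:
  `W = ⊕_N B_N`).
* §2 (`G ≤ Aut M`, `W = 𝓗¹(M)`): **`iSupIndep_biSup_iInf_eigenspace_ker_oneFormRep`** («injective on the level of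
  the tangent spaces»), `iSup_biSup_iInf_eigenspace_ker_oneFormRep_eq_invariants_commutator` (the parts of the cyclic
  quotients fill `𝓗¹(M)^{G'}`), **`isInternal_biSup_iInf_eigenspace_ker_oneFormRep`** («In case `G` is Abelian, this
  map is surjective, and yields a decomposition»: `𝓗¹(M) = ⊕_N B_N`).

## References

* Y. Kopeliovich, S. Zemel, *On spaces associated with invariant divisors on Galois covers of Riemann surfaces and
  their applications*, Israel J. Math. 234 (2019), Theorem 7.3 and its proof (arXiv:1609.02296 p. 32).
  [KopeliovichZemel2019]
* J.-P. Serre, *Linear Representations of Finite Groups*, GTM 42 (1977), §2.6 Theorem 8. [SerreLinearRepresentations1977]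
-/

noncomputable section

open scoped Manifold ContDiff Topology
open Set Filter Function Complex MulAction Module

namespace Literature.Geometry.Kaehler

namespace RiemannSurface

/-! ### §1 The parts `B_N = ⊕_{ker χ = N} E_χ` of a representation of a finite group -/

section General

variable {G : Type*} [Group G] [Fintype G] {W : Type*} [AddCommGroup W] [Module ℂ W] (σ : Representation ℂ G W)

omit [Fintype G] in
/-- `Σ_{N' ≠ N} B_{N'} ≤ ⊕_{ker χ ≠ N} E_χ`. [cite: KopeliovichZemel2019, Theorem 7.3 (proof)] -/
theorem biSup_biSup_iInf_eigenspace_ker_ne_le (N : Subgroup G) :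
    (⨆ (N' : Subgroup G) (_ : N' ≠ N), ⨆ (χ : G →* ℂˣ) (_ : χ.ker = N'),
        ⨅ g : G, Module.End.eigenspace (σ g) (χ g : ℂ)) ≤
      ⨆ (χ : G →* ℂˣ) (_ : χ.ker ≠ N), ⨅ g : G, Module.End.eigenspace (σ g) (χ g : ℂ) :=
  iSup₂_le fun _ hN' ↦ iSup₂_le fun χ hχ ↦
    le_iSup₂ (f := fun (χ : G →* ℂˣ) (_ : χ.ker ≠ N) ↦ ⨅ g : G, Module.End.eigenspace (σ g) (χ g : ℂ)) χ
      (hχ ▸ hN')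

/-- **«The map `∏_Q B_Q → J(X)` … is injective on the level of the tangent spaces»: the parts
`B_N = ⊕_{ψ : ker ψ = N} E_ψ`, `N ≤ G`, of a representation of ANY finite group are independent** (the `E_χ`,
`χ ∈ Ĝ`, are independent and the `B_N` are sums over disjoint sets of characters).
[cite: KopeliovichZemel2019, Theorem 7.3] [cite: SerreLinearRepresentations1977, §2.6 Theorem 8] -/
theorem iSupIndep_biSup_iInf_eigenspace_ker :
    iSupIndep fun N : Subgroup G ↦
      ⨆ (χ : G →* ℂˣ) (_ : χ.ker = N), ⨅ g : G, Module.End.eigenspace (σ g) (χ g : ℂ) := by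
  intro N
  have h := (iSupIndep_iInf_eigenspace σ).disjoint_biSup_biSup
    (s := {χ : G →* ℂˣ | χ.ker = N}) (t := {χ : G →* ℂˣ | χ.ker ≠ N})
    (Set.disjoint_left.2 fun χ (hχ : χ.ker = N) (hχ' : χ.ker ≠ N) ↦ hχ' hχ)
  simp only [Set.mem_setOf_eq] at h
  exact h.mono_right (biSup_biSup_iInf_eigenspace_ker_ne_le σ N)

omit [Fintype G] in
/-- `Σ_N B_N = Σ_{χ ∈ Ĝ} E_χ` (every character has exactly one kernel). [cite: KopeliovichZemel2019, Theorem 7.3 (proof)] -/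
theorem iSup_biSup_iInf_eigenspace_ker_eq :
    (⨆ N : Subgroup G, ⨆ (χ : G →* ℂˣ) (_ : χ.ker = N), ⨅ g : G, Module.End.eigenspace (σ g) (χ g : ℂ)) =
      ⨆ χ : G →* ℂˣ, ⨅ g : G, Module.End.eigenspace (σ g) (χ g : ℂ) := by
  rw [iSup_comm]
  exact iSup_congr fun χ ↦ iSup_iSup_eq_right

/-- **`Σ_N B_N = W^{G'}`**, `G' = [G, G]`: the parts of the cyclic quotients fill exactly the vectors on which `G`
acts through its abelianization (the pull-back of `𝓗¹(M/G')` in the curve case).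
[cite: KopeliovichZemel2019, Theorem 7.3 (proof)] [cite: SerreLinearRepresentations1977, §2.6 Theorem 8] -/
theorem iSup_biSup_iInf_eigenspace_ker_eq_invariants_commutator :
    (⨆ N : Subgroup G, ⨆ (χ : G →* ℂˣ) (_ : χ.ker = N), ⨅ g : G, Module.End.eigenspace (σ g) (χ g : ℂ)) =
      Representation.invariants (σ.comp (commutator G).subtype) := by
  rw [iSup_biSup_iInf_eigenspace_ker_eq, iSup_iInf_eigenspace_eq_invariants_commutator]

/-- **`B_N = 0` unless `G/N` is cyclic** («cyclic quotients»: a kernel `N = ker χ` has `G/N ↪ S¹` cyclic).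
[cite: KopeliovichZemel2019, Theorem 7.3 (proof: «characters of G map G onto finite (hence cyclic) subgroups of S¹»)] -/
theorem biSup_iInf_eigenspace_ker_eq_bot_of_not_isCyclic (N : Subgroup G) [N.Normal] (hN : ¬ IsCyclic (G ⧸ N)) :
    (⨆ (χ : G →* ℂˣ) (_ : χ.ker = N), ⨅ g : G, Module.End.eigenspace (σ g) (χ g : ℂ)) = ⊥ := by
  rw [eq_bot_iff]
  refine iSup₂_le fun χ hχ ↦ absurd ?_ hN
  haveI := isCyclic_quotient_ker_char χ
  exact isCyclic_of_surjective (QuotientGroup.quotientMulEquivOfEq hχ)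
    (QuotientGroup.quotientMulEquivOfEq hχ).surjective

omit [Fintype G] in
/-- `B_N = 0` unless `N` is normal (kernels are normal). [cite: KopeliovichZemel2019, Theorem 7.3] -/
theorem biSup_iInf_eigenspace_ker_eq_bot_of_not_normal (N : Subgroup G) (hN : ¬ N.Normal) :
    (⨆ (χ : G →* ℂˣ) (_ : χ.ker = N), ⨅ g : G, Module.End.eigenspace (σ g) (χ g : ℂ)) = ⊥ := by
  rw [eq_bot_iff]
  exact iSup₂_le fun χ hχ ↦ absurd (hχ ▸ (inferInstance : χ.ker.Normal)) hN

/-- **«In case `G` is Abelian, this map is surjective, and yields a decomposition»: `W = ⊕_{N ≤ G} B_N`** as an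
internal direct sum, for a finite abelian group (the non-zero summands being the `B_N` with `G/N` cyclic).
[cite: KopeliovichZemel2019, Theorem 7.3] [cite: SerreLinearRepresentations1977, §2.6 Theorem 8] -/
theorem isInternal_biSup_iInf_eigenspace_ker [DecidableEq (Subgroup G)] (hcomm : ∀ a b : G, a * b = b * a) :
    DirectSum.IsInternal fun N : Subgroup G ↦
      ⨆ (χ : G →* ℂˣ) (_ : χ.ker = N), ⨅ g : G, Module.End.eigenspace (σ g) (χ g : ℂ) :=
  DirectSum.isInternal_submodule_of_iSupIndep_of_iSup_eq_top (iSupIndep_biSup_iInf_eigenspace_ker σ)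
    (by rw [iSup_biSup_iInf_eigenspace_ker_eq, iSup_iInf_eigenspace_eq_top σ hcomm])

end General

/-! ### §2 Theorem 7.3 for `𝓗¹(M)`, `G ≤ Aut M` -/

section OneForms

variable {M : Type*} [TopologicalSpace M] [ChartedSpace ℂ M] [IsManifold 𝓘(ℂ, ℂ) ω M]
  (G : Subgroup (autGroup M)) [Fintype ↥G]

/-- **THEOREM 7.3, «injective on the level of the tangent spaces»**: for any finite `G ≤ Aut M` the parts
`B_N = ⊕_{ψ ∈ Ĝ : ker ψ = N} E_ψ(𝓗¹(M))` of the cyclic quotients `Q = G/N` are independent subspaces of `𝓗¹(M)`.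
[cite: KopeliovichZemel2019, Theorem 7.3] -/
theorem iSupIndep_biSup_iInf_eigenspace_ker_oneFormRep :
    iSupIndep fun N : Subgroup ↥G ↦
      ⨆ (χ : ↥G →* ℂˣ) (_ : χ.ker = N), ⨅ h : ↥G, Module.End.eigenspace (oneFormRep M (h : autGroup M)) (χ h : ℂ) :=
  iSupIndep_biSup_iInf_eigenspace_ker ((oneFormRep M).comp G.subtype)

/-- The parts of the cyclic quotients fill `𝓗¹(M)^{G'} = f_{G'}^*𝓗¹(M/G')`: `Σ_N B_N = 𝓗¹(M)^{[G,G]}` for any finite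
`G ≤ Aut M`. [cite: KopeliovichZemel2019, Theorem 7.3 (proof)] [cite: SerreLinearRepresentations1977, §2.6 Theorem 8] -/
theorem iSup_biSup_iInf_eigenspace_ker_oneFormRep_eq_invariants_commutator :
    (⨆ N : Subgroup ↥G, ⨆ (χ : ↥G →* ℂˣ) (_ : χ.ker = N),
        ⨅ h : ↥G, Module.End.eigenspace (oneFormRep M (h : autGroup M)) (χ h : ℂ)) =
      Representation.invariants (((oneFormRep M).comp G.subtype).comp (commutator ↥G).subtype) :=
  iSup_biSup_iInf_eigenspace_ker_eq_invariants_commutator ((oneFormRep M).comp G.subtype)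

/-- **THEOREM 7.3 for an ABELIAN `G ≤ Aut M`: `𝓗¹(M) = ⊕_{N ≤ G} B_N`** as an internal direct sum — the cotangent
form of «`J(X)` is isogenous to `∏_Q B_Q`, the product over the cyclic quotients `Q = G/N`» (`B_N = 0` unless
`G/N` is cyclic; `dim B_N` and `g = Σ_N dim B_N` are in `RiemannSurfaceAbelianCoverCyclicQuotientDecomposition`).
[cite: KopeliovichZemel2019, Theorem 7.3] -/
theorem isInternal_biSup_iInf_eigenspace_ker_oneFormRep [DecidableEq (Subgroup ↥G)]
    (hcomm : ∀ a b : ↥G, a * b = b * a) :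
    DirectSum.IsInternal fun N : Subgroup ↥G ↦
      ⨆ (χ : ↥G →* ℂˣ) (_ : χ.ker = N), ⨅ h : ↥G, Module.End.eigenspace (oneFormRep M (h : autGroup M)) (χ h : ℂ) :=
  isInternal_biSup_iInf_eigenspace_ker ((oneFormRep M).comp G.subtype) hcomm

end OneForms

end RiemannSurface

end Literature.Geometry.Kaehler
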